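import Literature.NumberTheory.Automorphic.KNAQuotientIntegration
import Literature.NumberTheory.Automorphic.GLnStandardLeviUnimodular
import Literature.NumberTheory.Automorphic.UnipotentRadicalCompactOpenProofs
import Literature.NumberTheory.Automorphic.GLnTwoBlockLeviStructure
import Literature.NumberTheory.Automorphic.ParabolicInductionProofs
import Literature.NumberTheory.Automorphic.TateLocalZetaShells
import HarnessLib

/-!
# A left Haar measure on `P_c = M_c ⋉ U_c ≤ GL_N(F)` in coordinates `p = m u`: `∫_P g dμ_P = ∫_M ∫_U g(m u) dμ_U dν_M`, and `τ(mu) = χ(m) δ^{1∕2}(m)`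
# (Folland §2.6; Bernstein–Zelevinsky 1977 §1.8, §2.3)

Topic `NumberTheory/Automorphic`; namespace `Literature.NumberTheory.Automorphic`.  THEOREMS ONLY (no definition, no instance, no notation, no named fact, no `sorry`).
Cell `pub/hodgecm-mathlib`, line «CMCharIdentityTest» — brick VD-5 (ii-a) of the `stub_vanDijkGL` road (census `B-provers/B-p18/g31/CENSUS-VD-vanDijkGL-road.B-p18g31.md`):
the two ingredients that unfold `∫_P f(k⁻¹ p k) τ(p) dμ_P` in ★ VD-3 `Representation.smoothTrace_smoothIndRep_eq_integral_kernel_diag` along `P_c = M_c ⋉ U_c`.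
* §1 **`GLn.exists_haar_parabolic_integral_eq_levi_unipotent`** — for Haar measures `ν_M` on `↥M_c` and `μ_U` on `↥U_c` there is a (left) HAAR measure `μ_P` on `↥P_c` with
  `∫_P g dμ_P = ∫_M ∫_U g(m u) dμ_U dν_M` for every continuous compactly supported `g : ↥P_c → ℂ` — `μ_P` is the push-forward of `ν_M ⊗ μ_U` along `(m,u) ↦ m u`
  (★ `isHaarMeasure_map_anMap`: LEFT-invariant because `M_c` normalises `U_c`, ★ `conj_mem_unipotentRadicalGL_of_mem_standardLeviGL`; the
  homeomorphism `M_c × U_c ≃ₜ P_c` is ★ `exists_homeomorph_levi_prod_unipotent_coe_eq`); Fubini for continuous compactly supported integrands.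
* §2 **`GLn.twist_leviProjection_rootDeltaChar_levi_mul_unipotent`** — the inducing character `τ = (χ ∘ leviProjection) · δ_{P_c}^{1∕2}` satisfies
  `τ(m u) = χ(leviProjection m) · δ^{1∕2}(m)` (`u ∈ U_c = ker leviProjection`, ★ `rootDeltaChar_eq_one_of_mem_unipotentRadicalP`).
HONEST LABEL: HC_CM is proved only modulo the printed citations (2 remaining named inputs hLiu418, h413) until rung 0 closes; this file is Haar bookkeeping.

## References
* [Folland1995] G. B. Folland, *A Course in Abstract Harmonic Analysis* (1995), §2.6.
* [BernsteinZelevinsky1977] I. N. Bernstein, A. V. Zelevinsky, *Induced representations of reductive 𝔭-adic groups I*, §1.8, §2.3.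
* [GetzHahn2024] J. R. Getz, H. Hahn, *An Introduction to Automorphic Representations* (2024), Prop. 3.2.1.
-/

set_option autoImplicit false

noncomputable section

open MeasureTheory MeasureTheory.Measure Topology
open scoped MatrixGroups

namespace Literature.NumberTheory.Automorphic

open Literature.NumberTheory.GaloisRepresentations.IsNonarchimedeanLocalField

variable {F : Type} [Field F] [ValuativeRel F] [TopologicalSpace F] [IsNonarchimedeanLocalField F]
  {n : ℕ} {α : Type*} [LinearOrder α] [Fintype α] {c : Fin n → α}
  [MeasurableSpace (GL (Fin n) F)] [BorelSpace (GL (Fin n) F)]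

omit [MeasurableSpace (GL (Fin n) F)] [BorelSpace (GL (Fin n) F)] in
/-- `GL_n(F)` is second countable. [folklore] -/
private theorem secondCountableTopology_GL₃ : SecondCountableTopology (GL (Fin n) F) := by
  haveI : SecondCountableTopology F := secondCountableTopology_localField F
  haveI : SecondCountableTopology (Matrix (Fin n) (Fin n) F) :=
    inferInstanceAs (SecondCountableTopology (Fin n → Fin n → F))
  haveI : SecondCountableTopology (Matrix (Fin n) (Fin n) F)ᵐᵒᵖ :=
    MulOpposite.opHomeomorph.symm.secondCountableTopology
  exact Units.isEmbedding_embedProduct.secondCountableTopology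

omit [MeasurableSpace (GL (Fin n) F)] [BorelSpace (GL (Fin n) F)] in
/-- `GL_n(F)` is locally compact. [folklore] -/
private theorem locallyCompactSpace_GL₃ : LocallyCompactSpace (GL (Fin n) F) := by
  haveI : T2Space F := (isLocalField F).toT2Space
  haveI : LocallyCompactSpace F := (isLocalField F).toLocallyCompactSpace
  haveI : LocallyCompactSpace (Matrix (Fin n) (Fin n) F) :=
    inferInstanceAs (LocallyCompactSpace (Fin n → Fin n → F))
  infer_instance

/-! ## §1 `∫_P g dμ_P = ∫_M ∫_U g(m u)` for a left Haar measure `μ_P` -/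

/-- **A left Haar measure on `P_c` in the coordinates `p = m u`**: for Haar `ν_M` on `M_c` and `μ_U` on `U_c` there is a Haar measure `μ_P` on `P_c` (the push-forward of
`ν_M ⊗ μ_U` along `(m, u) ↦ m u`) with `∫_P g dμ_P = ∫_M ∫_U g(m u) dμ_U dν_M` for all continuous compactly supported `g`.
[cite: Folland1995, §2.6] [cite: BernsteinZelevinsky1977, §2.3] -/
theorem GLn.exists_haar_parabolic_integral_eq_levi_unipotent
    (νM : Measure ↥(standardLeviGL F c)) [νM.IsHaarMeasure] (μU : Measure ↥(unipotentRadicalGL F c)) [μU.IsHaarMeasure] :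
    ∃ μP : Measure ↥(standardParabolicGL F c), μP.IsHaarMeasure ∧
      ∀ g : ↥(standardParabolicGL F c) → ℂ, Continuous g → HasCompactSupport g →
        ∫ p, g p ∂μP = ∫ m : ↥(standardLeviGL F c), ∫ u : ↥(unipotentRadicalGL F c),
          g ⟨(m : GL (Fin n) F) * (u : GL (Fin n) F), (standardParabolicGL F c).mul_mem (standardLeviGL_le F c m.2) (unipotentRadicalGL_le F c u.2)⟩ ∂μU ∂νM := by
  haveI : SecondCountableTopology (GL (Fin n) F) := secondCountableTopology_GL₃
  haveI : LocallyCompactSpace (GL (Fin n) F) := locallyCompactSpace_GL₃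
  haveI : T2Space F := (isLocalField F).toT2Space
  haveI : SecondCountableTopology ↥(standardLeviGL F c) := inferInstanceAs (SecondCountableTopology ↥((standardLeviGL F c : Set (GL (Fin n) F))))
  haveI : SecondCountableTopology ↥(unipotentRadicalGL F c) :=
    inferInstanceAs (SecondCountableTopology ↥((unipotentRadicalGL F c : Set (GL (Fin n) F))))
  haveI : BorelSpace (↥(standardLeviGL F c) × ↥(unipotentRadicalGL F c)) := Prod.borelSpace
  -- σ-finiteness of the Haar measures on the closed subgroups `M_c`, `U_c` (closed in the σ-compact `GL_n(F)`)
  haveI : SigmaCompactSpace (GL (Fin n) F) := sigmaCompactSpace_of_locallyCompact_secondCountable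
  haveI : SigmaCompactSpace ↥(standardLeviGL F c) := (isClosed_standardLeviGL (R := F) c).isClosedEmbedding_subtypeVal.sigmaCompactSpace
  haveI : SigmaCompactSpace ↥(unipotentRadicalGL F c) := (isClosed_unipotentRadicalGL (R := F) c).isClosedEmbedding_subtypeVal.sigmaCompactSpace
  haveI : SigmaFinite νM := inferInstance
  haveI : SigmaFinite μU := inferInstance
  obtain ⟨e, he⟩ := exists_homeomorph_levi_prod_unipotent_coe_eq (R := F) (c := c)
  have he' : ∀ q, e q = anMap (standardLeviGL F c) (unipotentRadicalGL F c) (standardParabolicGL F c)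
      (standardLeviGL_le F c) (unipotentRadicalGL_le F c) q := fun q => Subtype.ext (he q)
  haveI hHaar := isHaarMeasure_map_anMap (standardParabolicGL F c) (standardLeviGL_le F c) (unipotentRadicalGL_le F c)
    (fun m hm u hu => conj_mem_unipotentRadicalGL_of_mem_standardLeviGL (R := F) c hm hu) νM μU e he'
  refine ⟨_, hHaar, fun g hg hgs => ?_⟩
  have hcoe : (anMap (standardLeviGL F c) (unipotentRadicalGL F c) (standardParabolicGL F c)
      (standardLeviGL_le F c) (unipotentRadicalGL_le F c) : _ → ↥(standardParabolicGL F c)) = e := funext fun q => (he' q).symm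
  rw [hcoe, show (e : _ → ↥(standardParabolicGL F c)) = e.toMeasurableEquiv from rfl, integral_map_equiv e.toMeasurableEquiv]
  -- Fubini on `M × U`: `g ∘ e` is continuous with compact support
  have hge : Integrable (fun q : ↥(standardLeviGL F c) × ↥(unipotentRadicalGL F c) => g (e q)) (νM.prod μU) :=
    (hg.comp e.continuous).integrable_of_hasCompactSupport (hgs.comp_homeomorph e)
  rw [show (fun q => g (e.toMeasurableEquiv q)) = fun q => g (e q) from rfl, integral_prod _ hge]
  refine integral_congr_ae (Filter.Eventually.of_forall fun m => integral_congr_ae (Filter.Eventually.of_forall fun u => ?_))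
  simp only
  congr 1
  exact Subtype.ext (he (m, u))

/-! ## §2 The inducing character on `m u` -/

omit [MeasurableSpace (GL (Fin n) F)] [BorelSpace (GL (Fin n) F)] in
/-- **`τ(m u) = χ(leviProjection m) · δ^{1∕2}(m)`** for `m ∈ M_c`, `u ∈ U_c`: `u` lies in the kernel of `leviProjection` (★ `unipotentRadicalGL_subgroupOf`) and of `δ^{1∕2}`
(★ `rootDeltaChar_eq_one_of_mem_unipotentRadicalP`). [cite: BernsteinZelevinsky1977, §1.8] -/
theorem GLn.twist_leviProjection_rootDeltaChar_levi_mul_unipotent [LocallyCompactSpace ↥(standardParabolicGL F c)]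
    (χ : (Π a, GL {i : Fin n // c i = a} F) →* ℂˣ) (m : ↥(standardLeviGL F c)) (u : ↥(unipotentRadicalGL F c)) :
    χ (leviProjection F c ⟨(m : GL (Fin n) F) * (u : GL (Fin n) F), (standardParabolicGL F c).mul_mem (standardLeviGL_le F c m.2) (unipotentRadicalGL_le F c u.2)⟩) *
        rootDeltaChar (standardParabolicGL F c)
          ⟨(m : GL (Fin n) F) * (u : GL (Fin n) F), (standardParabolicGL F c).mul_mem (standardLeviGL_le F c m.2) (unipotentRadicalGL_le F c u.2)⟩ =
      χ (leviProjection F c ⟨(m : GL (Fin n) F), standardLeviGL_le F c m.2⟩) * rootDeltaChar (standardParabolicGL F c) ⟨(m : GL (Fin n) F), standardLeviGL_le F c m.2⟩ := by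
  have huP : (⟨(u : GL (Fin n) F), unipotentRadicalGL_le F c u.2⟩ : ↥(standardParabolicGL F c)) ∈ unipotentRadicalP F c := by
    rw [← unipotentRadicalGL_subgroupOf]
    exact Subgroup.mem_subgroupOf.2 u.2
  have hmul : (⟨(m : GL (Fin n) F) * (u : GL (Fin n) F), (standardParabolicGL F c).mul_mem (standardLeviGL_le F c m.2) (unipotentRadicalGL_le F c u.2)⟩ :
      ↥(standardParabolicGL F c)) = ⟨(m : GL (Fin n) F), standardLeviGL_le F c m.2⟩ * ⟨(u : GL (Fin n) F), unipotentRadicalGL_le F c u.2⟩ := rfl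
  rw [hmul, map_mul, map_mul, (MonoidHom.mem_ker).1 huP, map_one, mul_one, map_mul, rootDeltaChar_eq_one_of_mem_unipotentRadicalP (F := F) c huP, mul_one]

end Literature.NumberTheory.Automorphic

end
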